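import Summits.KontsevichZagierPeriods.KontsevichZagierPeriods.Theorems.LinRedNormalFormHoffmanSpanInKZLeThirteen

/-!
# Crux `LinRedNormalForm.HoffmanSpanInKZ` (stmt-KontsevichZagierPeriods-15044) — skeleton of line `Sketch`, v6

The crux: every MZV word generator `[Δ_w, q·∏ ω_ε]` is congruent modulo `KZ.relations` to a
`ℤ`-combination of Hoffman generators `[Δ_w, q'·ω_u]`, `u ∈ {2,3}^×`, `|u| = w`.

v6 (continuation lead c3, 2026-08-17): EVERYTHING IS LANDED EXCEPT THE TAIL, and the composition itself is
now a tree theorem — `stub_cruxOfEdsTail : (∀ N ≥ 14, EdsCertificate N) → HoffmanSpanInKZ`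
(`Theorems/LinRedNormalFormHoffmanSpanInKZLeThirteen.lean`, p163014), assembling
* the read-back `hoffmanSpanInKZ_iff : HoffmanSpanInKZ ↔ ∀ N, SpanAt N` and the spanning transfer
  `stub_spanTransfer : ∀ N, EdsCertificate N → SpanAt N` (p96280) over the landed calculus half
  (realisation, shuffle = dissection, stuffle, Hoffman's relation, duality);
* the rungs `N ≤ 10` (`edsCertificate_of_le_ten`, p124619), `N = 11` (p135946), `N = 12` (p144748),
  `N = 13` (p145162) — milestone `stub_leThirteen : ∀ N ≤ 13, SpanAt N` (p163014): the crux holds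
  UNCONDITIONALLY in every weight `≤ 13`;
* so that `hoffmanSpanInKZ_iff_tail : HoffmanSpanInKZ ↔ ∀ N ≥ 14, SpanAt N` and
  `edsComplete_iff_tail : EdsComplete ↔ ∀ N ≥ 14, EdsCertificate N` (p163014).

The single open stub `stub_edsTail : ∀ N ≥ 14, EdsCertificate N` is the upper-bound half of the dimension
conjecture for FORMAL (extended-double-shuffle) multiple zeta values with Hoffman generators: verified in
print for `N ≤ 22` (Kaneko–Noro–Tsurumaki 2008; Machide 2023, arXiv:2205.13751), by exact rank here for
`N ≤ 15`, kernel-checked for `N ≤ 13`; OPEN in general — Burmester–Confurius–Kühn 2024 (arXiv:2406.13630,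
Cor. 1.5) derive it from the free-odd-generation conjecture for the double shuffle Lie algebra `dm₀`, and
no unconditional proof is known. It is CONJECTURE-SIZED, not stub-sized (lead c3 verdict: promote-stub;
evidence `tail-verdict-c3.md`). Any proof of it proves Brown's theorem at the value level
(`hoffmanSpan_eq_mzvSpace_of_hoffmanSpanInKZ`, `…HoffmanIndependenceRealSpanning`).

Sources: F. Brown, *Mixed Tate motives over ℤ*, Ann. of Math. 175 (2012), Thm 1.1; K. Ihara, M. Kaneko,
D. Zagier, Compos. Math. 142 (2006), §1; M. Kaneko, M. Noro, K. Tsurumaki, IMA Vol. Math. Appl. 148 (2008);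
T. Machide, Tsukuba J. Math. 47 (2023); A. Burmester, N. Confurius, U. Kühn, arXiv:2406.13630 (2024);
M. E. Hoffman, J. Algebra 194 (1997); M. Kontsevich, D. Zagier, *Periods* (2001), §1.2.
-/

noncomputable section

namespace Summit.KontsevichZagierPeriods.LinRedNormalForm.HoffmanSpanInKZ

open Literature.NumberTheory.Transcendental
open Summit.KontsevichZagierPeriods.MzvKernelInKZ.Negative
open Summit.KontsevichZagierPeriods.MzvKernelInKZ.TwoPosets
open Summit.KontsevichZagierPeriods.KontsevichZagierPeriods.Theses.LinRedNormalForm (HoffmanSpanInKZ)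

/-! ## Registered stubs -/

/-- Stub (THE OPEN TAIL, conjecture-sized): EDS certificates in every weight `N ≥ 14` —
Hoffman-completeness of finite double shuffle + Hoffman's relation + duality in all weights (the
upper-bound half of the dimension conjecture for formal MZVs; ⇐ free odd generation of `dm₀`). -/
theorem stub_edsTail : ∀ N : ℕ, 14 ≤ N → EdsCertificate N := by
  sorry

/-! ## Composition -/

/-- **The crux from the stub**: `HoffmanSpanInKZ`, through the landed composition `stub_cruxOfEdsTail`
(rungs `N ≤ 13` + spanning transfer in the weights `≥ 14`). -/
theorem HoffmanSpanInKZ_of : HoffmanSpanInKZ :=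
  stub_cruxOfEdsTail stub_edsTail

end Summit.KontsevichZagierPeriods.LinRedNormalForm.HoffmanSpanInKZ
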